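import Literature.NumberTheory.Sieve.DivisorBound
import HarnessLib

/-!
# The top rung of the Chebyshev–Hooley ladder is Conjecture E

Companion of `SoloInformedChebyshevHooleyRows`.  The Chebyshev–Hooley moduli count of `ℓ² + 1`,
`c_X(k) = #{1 ≤ ℓ ≤ X : k ∣ ℓ² + 1}` (written inline as `#((Icc 1 X).filter (k ∣ ·² + 1))`), is the
object of every quantified result towards primes of the form `n² + 1` (Hooley 1967, …,
Grimmelt–Merikoski 2025: `P⁺(n² + 1) > n^{1.312}` infinitely often, via `c_X(p)` for primes
`p ≍ X^α`, `α ≤ 1.312`).  This file records, as exact elementary identities, where that ladder ends: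

* `chCount_top` — for `2k > X² + 1` the count `c_X(k)` is `#{1 ≤ ℓ ≤ X : ℓ² + 1 = k} ≤ 1`
  (`card_filter_sq_add_one_eq_le_one`): at the top rung the moduli sequence IS the indicator of the
  value set `{ℓ² + 1}`;
* `sum_primes_chCount_top` — DICTIONARY TO THE SUMMIT: the prime-moduli count at the top rung is the
  Conjecture-E count on the top dyadic range,
  `∑_{(X²+1)/2 < p ≤ X²+1, p prime} c_X(p) = #{1 ≤ ℓ ≤ X : (X²+1)/2 < ℓ² + 1, ℓ² + 1 prime}`
  (the right side is `polyPrimeCount ![X² + 1]` of `Literature.NumberTheory.Sieve.BatemanHorn`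
  restricted to `ℓ² + 1 > (X² + 1)/2`);
* `card_primes_gt_dvd_le_one`, `sum_primes_gt_chCount_le` — the Chebyshev–Hooley budget in counting
  form: `ℓ² + 1 ≤ X² + 1` has at most one prime factor `> X`, so `∑_{X < p ≤ X²+1} c_X(p) ≤ X`.

Reading.  Rung `α` of the ladder asks for an asymptotic for `∑_{p ∼ X^α} c_X(p) log p`; it is a
theorem for `α ≤ 1 + o(1)` only (Duke–Friedlander–Iwaniec 1995; Merikoski, JEMS 2023
[arXiv:1908.08816, §4: "Currently we have an asymptotic formula for S(x,P) only in the range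
P = x^{1+o(1)}"]), the exponents `1.279, 1.3, 1.312` being Harman-sieve bounds, not asymptotics; by
`sum_primes_chCount_top` the rung `α = 2` is Conjecture E itself, and by
`SoloInformedChebyshevHooleyRows` the bilinear (Type-II) structure used on every lower rung is
confined to `X^{α−1−o(1)} ≤ N ≤ M ≤ X^{1+o(1)}`, degenerate at `α = 2`. [folklore]
-/

open Finset

namespace Summit.Parity.BatemanHorn.Theorems

/-- **Top rung = value set.**  If `2k > X² + 1` then `k ∣ ℓ² + 1` with `1 ≤ ℓ ≤ X` forces
`ℓ² + 1 = k`: `c_X(k) = #{1 ≤ ℓ ≤ X : ℓ² + 1 = k}`. [folklore] -/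
theorem chCount_top {X k : ℕ} (hk : X ^ 2 + 1 < 2 * k) :
    #((Icc 1 X).filter (fun ℓ : ℕ => k ∣ ℓ ^ 2 + 1)) =
      #((Icc 1 X).filter (fun ℓ : ℕ => ℓ ^ 2 + 1 = k)) := by
  have hset : (Icc 1 X).filter (fun ℓ : ℕ => k ∣ ℓ ^ 2 + 1) =
      (Icc 1 X).filter (fun ℓ : ℕ => ℓ ^ 2 + 1 = k) := by
    apply filter_congr
    intro ℓ hℓ
    have hℓX : ℓ ≤ X := (mem_Icc.mp hℓ).2
    have hsq : ℓ ^ 2 ≤ X ^ 2 := Nat.pow_le_pow_left hℓX 2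
    constructor
    · rintro ⟨q, hq⟩
      rcases q with _ | _ | q
      · omega
      · omega
      · have : 2 * k ≤ k * (q + 1 + 1) := by nlinarith
        omega
    · intro h
      rw [h]
  rw [hset]

/-- `ℓ ↦ ℓ² + 1` is injective: at most one `ℓ` has `ℓ² + 1 = k`. [folklore] -/
theorem card_filter_sq_add_one_eq_le_one (X k : ℕ) :
    #((Icc 1 X).filter (fun ℓ : ℕ => ℓ ^ 2 + 1 = k)) ≤ 1 := by
  refine card_le_one.mpr fun a ha b hb => ?_
  have ha' := (mem_filter.mp ha).2
  have hb' := (mem_filter.mp hb).2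
  have hab : a ^ 2 = b ^ 2 := by omega
  exact Nat.pow_left_injective (by norm_num : (2 : ℕ) ≠ 0) hab

/-- **Dictionary to the summit.**  The prime-moduli count of the Chebyshev–Hooley sequence at the
top rung equals the Conjecture-E count on the top dyadic range:
`∑_{(X²+1)/2 < p ≤ X²+1, p prime} c_X(p) = #{1 ≤ ℓ ≤ X : (X²+1)/2 < ℓ²+1 ∧ ℓ²+1 prime}`.
[folklore] -/
theorem sum_primes_chCount_top (X : ℕ) :
    ∑ p ∈ (Ioc ((X ^ 2 + 1) / 2) (X ^ 2 + 1)).filter Nat.Prime,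
        #((Icc 1 X).filter (fun ℓ : ℕ => p ∣ ℓ ^ 2 + 1)) =
      #((Icc 1 X).filter (fun ℓ : ℕ => (X ^ 2 + 1) / 2 < ℓ ^ 2 + 1 ∧ (ℓ ^ 2 + 1).Prime)) := by
  set s := (Icc 1 X).filter (fun ℓ : ℕ => (X ^ 2 + 1) / 2 < ℓ ^ 2 + 1 ∧ (ℓ ^ 2 + 1).Prime) with hs
  set t := (Ioc ((X ^ 2 + 1) / 2) (X ^ 2 + 1)).filter Nat.Prime with ht
  have H : ∀ ℓ ∈ s, ℓ ^ 2 + 1 ∈ t := by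
    intro ℓ hℓ
    obtain ⟨hℓI, hlt, hpr⟩ := mem_filter.mp hℓ
    have hℓX : ℓ ≤ X := (mem_Icc.mp hℓI).2
    have hsq : ℓ ^ 2 ≤ X ^ 2 := Nat.pow_le_pow_left hℓX 2
    exact mem_filter.mpr ⟨mem_Ioc.mpr ⟨hlt, by omega⟩, hpr⟩
  have key := card_eq_sum_card_fiberwise H
  rw [key]
  refine sum_congr rfl fun p hp => ?_
  obtain ⟨hpI, hpr⟩ := mem_filter.mp hp
  have hpl : (X ^ 2 + 1) / 2 < p := (mem_Ioc.mp hpI).1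
  rw [chCount_top (by omega)]
  have hset : (Icc 1 X).filter (fun ℓ : ℕ => ℓ ^ 2 + 1 = p) =
      s.filter (fun ℓ : ℕ => ℓ ^ 2 + 1 = p) := by
    rw [hs, filter_filter]
    apply filter_congr
    intro ℓ hℓ
    constructor
    · intro h
      refine ⟨⟨by omega, ?_⟩, h⟩
      rw [h]
      exact hpr
    · exact fun h => h.2
  rw [hset]

/-- Two distinct primes `> X` cannot both divide `ℓ² + 1 ≤ X² + 1`: the set of prime moduli
`p ∈ (X, X²+1]` dividing `ℓ² + 1` has at most one element. [folklore] -/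
theorem card_primes_gt_dvd_le_one {X ℓ : ℕ} (hℓ : ℓ ≤ X) :
    #(((Ioc X (X ^ 2 + 1)).filter Nat.Prime).filter (fun p : ℕ => p ∣ ℓ ^ 2 + 1)) ≤ 1 := by
  refine card_le_one.mpr fun p hp q hq => ?_
  by_contra hne
  obtain ⟨hp1, hpd⟩ := mem_filter.mp hp
  obtain ⟨hq1, hqd⟩ := mem_filter.mp hq
  obtain ⟨hpI, hpp⟩ := mem_filter.mp hp1
  obtain ⟨hqI, hqp⟩ := mem_filter.mp hq1
  have hpX : X < p := (mem_Ioc.mp hpI).1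
  have hqX : X < q := (mem_Ioc.mp hqI).1
  have hcop : Nat.Coprime p q := (Nat.coprime_primes hpp hqp).mpr hne
  have hdvd : p * q ∣ ℓ ^ 2 + 1 := hcop.mul_dvd_of_dvd_of_dvd hpd hqd
  have hle : p * q ≤ ℓ ^ 2 + 1 := Nat.le_of_dvd (Nat.succ_pos _) hdvd
  have hsq : ℓ ^ 2 ≤ X ^ 2 := Nat.pow_le_pow_left hℓ 2
  have hbig : (X + 1) * (X + 2) ≤ p * q := by
    rcases Nat.lt_or_gt_of_ne hne with h | h
    · have h2 : X + 2 ≤ q := by omega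
      exact Nat.mul_le_mul hpX h2
    · have h2 : X + 2 ≤ p := by omega
      rw [mul_comm p q]
      exact Nat.mul_le_mul hqX h2
  nlinarith

/-- **The Chebyshev–Hooley budget, counting form.**  `∑_{X < p ≤ X²+1, p prime} c_X(p) ≤ X`: every
`ℓ ≤ X` contributes to at most one prime modulus above `X`. [folklore] -/
theorem sum_primes_gt_chCount_le (X : ℕ) :
    ∑ p ∈ (Ioc X (X ^ 2 + 1)).filter Nat.Prime,
        #((Icc 1 X).filter (fun ℓ : ℕ => p ∣ ℓ ^ 2 + 1)) ≤ X := by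
  set t := (Ioc X (X ^ 2 + 1)).filter Nat.Prime with ht
  have hswap : ∑ p ∈ t, #((Icc 1 X).filter (fun ℓ : ℕ => p ∣ ℓ ^ 2 + 1)) =
      ∑ ℓ ∈ Icc 1 X, #(t.filter (fun p : ℕ => p ∣ ℓ ^ 2 + 1)) := by
    simp only [card_filter]
    exact sum_comm
  rw [hswap]
  calc ∑ ℓ ∈ Icc 1 X, #(t.filter (fun p : ℕ => p ∣ ℓ ^ 2 + 1))
      ≤ ∑ ℓ ∈ Icc 1 X, 1 :=
        sum_le_sum fun ℓ hℓ => card_primes_gt_dvd_le_one (mem_Icc.mp hℓ).2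
    _ = X := by simp

end Summit.Parity.BatemanHorn.Theorems
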